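import Summits.ValiantsHypothesis.ValiantsHypothesis.Theorems.KPlusLogSqLawTropicalBChangedSetExclusivity
import Summits.ValiantsHypothesis.ValiantsHypothesis.Theorems.KPlusLogSqLawTropicalBHalfThin

/-!
# Route «KPlusLogSqLaw», crux `TropicalB` (stmt-ValiantsHypothesis-19771) — the CHANGED-SET LAW for every `R`:
# `(R+1)(T(m,K)+1) ≤ (R+1)·m! + (K−1)·(Σ_{r=1}^{R} (R+1−r)·N_r + m!·m)`, `N_r = C(m,r)·m!/(m−r)! = C(m,r)²·r!`

HONEST FRAMING.  Helper toward the crux `Summit.ValiantsHypothesis.ValiantsHypothesis.Theses.KPlusLogSqLaw.TropicalB` (ledger item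
`stmt-ValiantsHypothesis-19771`, registered stubs `stub_tropThin` / `stub_tropFat` of `Cruxes/TropicalB/Lines/birth.lean`; cell
`pub-symmetroid`, seat val-sym-trop-p4 g5, 2026-08-27; `--supports … --as helper`).  Fourth file of the REFRESH-EXCLUSIVITY package of
val-sym-trop-p4 g4 (`…TropicalBRefreshExclusivity` p476155 = one-column structure; `…TropicalBHalfThin` p476649 = the `R = 1` count;
`…TropicalBChangedSetExclusivity` p477582 = the column-SET structure and the law `n + 1 ≤ |Π| + (K−1)·ν`): this file types the ARITHMETIC
that p477582's docstring left open; the uniform corollary `2(T(m,K)+1) ≤ 2·m! + 5·m!·(K−1)` is the sequel `…TropicalBFiveHalves`.  An upper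
bound in the SUPER-FAT corner `K ≫ m` (fixed size, many slope classes), i.e. OFF the window `⌊log₂ m⌋ + 1 < K < m` of the crux; nothing
here bears on `TropicalB` in the window, on `WeakLifting` / `Lifting`, on the cell's real census / DoorA26 / DoorA34, on `MatrixDescartes`
(stmt-ValiantsHypothesis-18050) or on VP ≠ VNP.  Write `T(m,K)` for the least `B` with `TropRootLawAt m K B`, `Π` for the set of
permutations used by a sign-alternating dominant chain of `n + 1` terms, and call a STEP a pair `i < k` of consecutive uses of one
permutation; its SIGNATURE is the changed cell-set `{(σ b, b) : class of column b switched}` (a nonempty partial permutation matrix).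

CONTENT.
* `card_sigFibre_le`: each signature carries `≤ K − 1` steps (fibre form of p477582's `card_signature_le`, isolated for re-use);
  `card_sig_pos`: signatures are nonempty (`chain_ne`).
* `succ_mul_succ_le_sig` (WEIGHTED STEP COUNT): for every `R`, `(R+1)(n+1) ≤ (R+1)|Π| + (K−1)·(Σ_{s ∈ Sig}(R+1−|s|) + |Π|·m)` — a step with
  `r` changed cells is charged `R+1−r` units to its signature and `r` units to the change mass `≤ (K−1)·m·|Π|` (`sum_card_chg_le`, p476649).
* `card_sig_filter_le` (PARTIAL PERMUTATION COUNT): the signatures of size `r` number `≤ N_r = C(m,r)·m!/(m−r)!` (graph of the permutation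
  over the `r` switched columns ↦ (column set, row labels in column order) ∈ `powersetCard r × (Fin r ↪ Fin m)`); `sum_sig_le` groups the
  signature charge by size.
* `succ_mul_succ_le_changedSet` / `tropRootLawAt_changedSet` (CHANGED-SET LAW): for every `R`,
  `(R+1)(n+1) ≤ (R+1)|Π| + (K−1)·(Σ_{r=1}^{R}(R+1−r)·N_r + m|Π|)`, hence
  `T(m,K) ≤ ⌊((R+1)·m! + (K−1)(Σ_{r=1}^{R}(R+1−r)N_r + m!·m))/(R+1)⌋ − 1`.  `R = 0` is the thin law (p406287 / p419330), `R = 1` the half-thin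
  law (p476649).  Rows: `m = 5` (`R = 2`; `N_1 = 25`, `N_2 = 200`): `T(5,K) ≤ 119 + ⌊850(K−1)/3⌋` (`283.3̇` per class vs half-thin `312.5`,
  thin `600`) — the first size where `R = 2` wins; `m = 6` (`R = 2`): `T(6,K) ≤ 719 + 1614(K−1)` (vs `2178`, `4320`); `m = 7` (`R = 3`):
  `T(7,K) ≤ 5039 + ⌊44541(K−1)/4⌋` (`11135.25` vs `17664.5`, `35280`).
Paper remark (not typed): the optimal `R ≈ m − e√m` gives `T(m,K) + 1 ≤ m! + (1 + O(1/√m))·m!·(K−1)`, i.e. asymptotically at most ONE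
revisit per permutation per class; LOWER SIDE for comparison (lineage rows): `T(2,K) = 4K − 7` (p443198), `6K − 11 ≤ T(3,K)` (memo); whether
the true slope of the `m`-row grows like `m!` or polynomially in `m` is OPEN.  [this cell; the counts are folklore]
-/

-- `Summit.ValiantsHypothesis.ValiantsHypothesis.…` repeats a component by the D-0017 layout
-- (single-conjunct summit), which the `dupNamespace` linter flags; the name is mandated.
set_option linter.dupNamespace false
set_option autoImplicit false

namespace Summit.ValiantsHypothesis.ValiantsHypothesis.Theorems.KPlusLogSqLaw

open Summit.ValiantsHypothesis.ValiantsHypothesis.Theorems.MatrixDescartes.Negative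
open Summit.ValiantsHypothesis.ValiantsHypothesis.Theorems.LacunarySymmetroidMatrixDescartes.TropicalCensus
open Finset

namespace RefreshExclusivity

/-! ## 1. The fibres of the changed-cell-set signature -/

section Chain

variable {m K n : ℕ} (d : Fin K → ℕ) (v ε : Fin m → Fin m → Fin K → ℤ) (θ : Fin (n + 1) → ℤ)
  (p : Fin (n + 1) → Equiv.Perm (Fin m) × (Fin m → Fin K))

/-- **SIGNATURE FIBRES.**  Among the steps of a sign-alternating dominant chain (pairs `i < k` of consecutive uses of one
permutation), those whose changed cell-set `{(σ b, b) : class of column b switched}` is a given set `s` number at most `K − 1`.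
(The fibre form of `card_signature_le`; it is the inequality behind `succ_le_card_perms_add`, isolated here for re-use.)
[this cell, val-sym-trop-p4 g4/g5] -/
theorem card_sigFibre_le (hθ : StrictMono θ) (hdom : ∀ k, IsDominant d v ε (θ k) (p k))
    (halt : ∀ k : Fin n, termSign ε (p k.castSucc) * termSign ε (p k.succ) < 0)
    (s : Finset (Fin m × Fin m)) :
    ((univ.filter fun ik : Fin (n + 1) × Fin (n + 1) =>
        ik.1 < ik.2 ∧ (p ik.1).1 = (p ik.2).1 ∧ ∀ j, ik.1 < j → j < ik.2 → (p j).1 ≠ (p ik.2).1).filter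
      fun ik => ((univ.filter fun b => (p ik.1).2 b ≠ (p ik.2).2 b).image fun b => ((p ik.2).1 b, b)) = s).card
      ≤ K - 1 := by
  classical
  set St : Finset (Fin (n + 1) × Fin (n + 1)) := univ.filter fun ik =>
      ik.1 < ik.2 ∧ (p ik.1).1 = (p ik.2).1 ∧ ∀ j, ik.1 < j → j < ik.2 → (p j).1 ≠ (p ik.2).1 with hSt
  have hStmem : ∀ ik, ik ∈ St ↔
      ik.1 < ik.2 ∧ (p ik.1).1 = (p ik.2).1 ∧ ∀ j, ik.1 < j → j < ik.2 → (p j).1 ≠ (p ik.2).1 := by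
    intro ik
    rw [hSt, Finset.mem_filter]
    exact ⟨fun h => h.2, fun h => ⟨mem_univ _, h⟩⟩
  set F := St.filter fun ik =>
      ((univ.filter fun b => (p ik.1).2 b ≠ (p ik.2).2 b).image fun b => ((p ik.2).1 b, b)) = s with hF
  rcases F.eq_empty_or_nonempty with h0 | ⟨x₁, hx₁⟩
  · rw [h0, Finset.card_empty]
    exact Nat.zero_le _
  obtain ⟨hx₁St, hsx₁⟩ := Finset.mem_filter.mp hx₁
  obtain ⟨hlt₁, hperm₁, -⟩ := (hStmem x₁).1 hx₁St
  -- the changed column set of `x₁`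
  set C := univ.filter fun b => (p x₁.1).2 b ≠ (p x₁.2).2 b with hC
  have hCmem : ∀ b, b ∈ C ↔ (p x₁.1).2 b ≠ (p x₁.2).2 b := by
    intro b
    rw [hC, Finset.mem_filter]
    exact ⟨fun h => h.2, fun h => ⟨mem_univ _, h⟩⟩
  have hCne : C.Nonempty := by
    by_contra h0
    rw [Finset.not_nonempty_iff_eq_empty] at h0
    apply chain_ne d v ε θ p hθ hdom halt hlt₁
    refine Prod.ext hperm₁ (funext fun b => ?_)
    by_contra hbne
    have : b ∈ C := (hCmem b).2 hbne
    rw [h0] at this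
    exact absurd this (Finset.notMem_empty b)
  obtain ⟨b, hb⟩ := hCne
  -- unpack «same signature as x₁»
  have hsig : ∀ x ∈ F,
      x ∈ St ∧ (∀ b', ((p x.1).2 b' ≠ (p x.2).2 b' ↔ b' ∈ C)) ∧ (∀ b' ∈ C, (p x.2).1 b' = (p x₁.2).1 b') := by
    intro x hx
    obtain ⟨hxSt, hxs⟩ := Finset.mem_filter.mp hx
    have heq : ((univ.filter fun b => (p x.1).2 b ≠ (p x.2).2 b).image fun b => ((p x.2).1 b, b)) =
        ((univ.filter fun b => (p x₁.1).2 b ≠ (p x₁.2).2 b).image fun b => ((p x₁.2).1 b, b)) := by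
      rw [hxs, hsx₁]
    have fwd : ∀ b', (p x.1).2 b' ≠ (p x.2).2 b' → b' ∈ C ∧ (p x.2).1 b' = (p x₁.2).1 b' := by
      intro b' hb'
      have hm : ((p x.2).1 b', b') ∈ (univ.filter fun b => (p x.1).2 b ≠ (p x.2).2 b).image
          fun b => ((p x.2).1 b, b) :=
        Finset.mem_image.mpr ⟨b', Finset.mem_filter.mpr ⟨mem_univ _, hb'⟩, rfl⟩
      rw [heq] at hm
      obtain ⟨b'', hb'', hpair⟩ := Finset.mem_image.mp hm
      obtain ⟨h1', h2'⟩ := Prod.mk.inj hpair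
      subst h2'
      exact ⟨(hCmem _).2 (Finset.mem_filter.mp hb'').2, h1'.symm⟩
    have bwd : ∀ b', b' ∈ C → (p x.1).2 b' ≠ (p x.2).2 b' := by
      intro b' hb'
      have hm : ((p x₁.2).1 b', b') ∈ (univ.filter fun b => (p x₁.1).2 b ≠ (p x₁.2).2 b).image
          fun b => ((p x₁.2).1 b, b) :=
        Finset.mem_image.mpr ⟨b', Finset.mem_filter.mpr ⟨mem_univ _, (hCmem b').1 hb'⟩, rfl⟩
      rw [← heq] at hm
      obtain ⟨b'', hb'', hpair⟩ := Finset.mem_image.mp hm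
      obtain ⟨-, h2'⟩ := Prod.mk.inj hpair
      subst h2'
      exact (Finset.mem_filter.mp hb'').2
    exact ⟨hxSt, fun b' => ⟨fun h => (fwd b' h).1, bwd b'⟩, fun b' hb' => (fwd b' (bwd b' hb')).2⟩
  refine card_signature_le d v ε θ p hθ hdom _ C hb (fun x hx => ?_) (fun x hx x' hx' b' hb' => ?_)
  · obtain ⟨hxSt, hchg, -⟩ := hsig x hx
    obtain ⟨hltx, hpermx, hbtwx⟩ := (hStmem x).1 hxSt
    refine ⟨hltx, hpermx, hbtwx, fun b' hb' => ?_, fun b' hb' => (hchg b').2 hb'⟩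
    by_contra hne
    exact hb' ((hchg b').1 hne)
  · obtain ⟨-, -, hr⟩ := hsig x hx
    obtain ⟨-, -, hr'⟩ := hsig x' hx'
    rw [hr b' hb', hr' b' hb']


/-- Signatures are nonempty: a step of a sign-alternating dominant chain changes at least one class (`chain_ne`). -/
theorem card_sig_pos (hθ : StrictMono θ) (hdom : ∀ k, IsDominant d v ε (θ k) (p k))
    (halt : ∀ k : Fin n, termSign ε (p k.castSucc) * termSign ε (p k.succ) < 0)
    {s : Finset (Fin m × Fin m)}
    (hs : s ∈ ((univ.filter fun ik : Fin (n + 1) × Fin (n + 1) =>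
        ik.1 < ik.2 ∧ (p ik.1).1 = (p ik.2).1 ∧ ∀ j, ik.1 < j → j < ik.2 → (p j).1 ≠ (p ik.2).1).image
      fun ik => (univ.filter fun b => (p ik.1).2 b ≠ (p ik.2).2 b).image fun b => ((p ik.2).1 b, b))) :
    0 < s.card := by
  classical
  obtain ⟨ik, hik, rfl⟩ := Finset.mem_image.mp hs
  obtain ⟨-, hlt, hperm, -⟩ := Finset.mem_filter.mp hik
  rw [Finset.card_pos, Finset.image_nonempty]
  by_contra h0
  rw [Finset.not_nonempty_iff_eq_empty, Finset.filter_eq_empty_iff] at h0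
  exact chain_ne d v ε θ p hθ hdom halt hlt (Prod.ext hperm (funext fun b => by
    by_contra hb
    exact h0 (mem_univ b) hb))

/-- **WEIGHTED STEP COUNT.**  For every `R`: `(R+1)(n+1) ≤ (R+1)|Π| + (K−1)·(Σ_{s ∈ Sig} (R+1−|s|) + |Π|·m)`, where `Π` is the
set of permutations of the chain and `Sig` the set of changed cell-sets occurring at its steps: a step with `r` changed cells is
charged `R + 1 − r` units to its signature (each signature carries `≤ K − 1` steps, `card_sigFibre_le`) and `r` units to the change
mass (`≤ (K−1)·m·|Π|`, `sum_card_chg_le`).  `R = 0` is the thin law, `R = 1` the half-thin law. [this cell, val-sym-trop-p4 g5] -/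
theorem succ_mul_succ_le_sig (hθ : StrictMono θ) (hdom : ∀ k, IsDominant d v ε (θ k) (p k))
    (halt : ∀ k : Fin n, termSign ε (p k.castSucc) * termSign ε (p k.succ) < 0) (R : ℕ) :
    (R + 1) * (n + 1) ≤ (R + 1) * (univ.image fun k => (p k).1).card + (K - 1) *
      ((∑ s ∈ ((univ.filter fun ik : Fin (n + 1) × Fin (n + 1) =>
          ik.1 < ik.2 ∧ (p ik.1).1 = (p ik.2).1 ∧ ∀ j, ik.1 < j → j < ik.2 → (p j).1 ≠ (p ik.2).1).image
        fun ik => (univ.filter fun b => (p ik.1).2 b ≠ (p ik.2).2 b).image fun b => ((p ik.2).1 b, b)),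
          (R + 1 - s.card)) + (univ.image fun k => (p k).1).card * m) := by
  classical
  -- steps: consecutive uses of a permutation
  set St : Finset (Fin (n + 1) × Fin (n + 1)) := univ.filter fun ik =>
      ik.1 < ik.2 ∧ (p ik.1).1 = (p ik.2).1 ∧ ∀ j, ik.1 < j → j < ik.2 → (p j).1 ≠ (p ik.2).1 with hSt
  have hStmem : ∀ ik, ik ∈ St ↔
      ik.1 < ik.2 ∧ (p ik.1).1 = (p ik.2).1 ∧ ∀ j, ik.1 < j → j < ik.2 → (p j).1 ≠ (p ik.2).1 := by
    intro ik
    rw [hSt, Finset.mem_filter]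
    exact ⟨fun h => h.2, fun h => ⟨mem_univ _, h⟩⟩
  -- the signature of a step: its changed cell-set
  set sig : Fin (n + 1) × Fin (n + 1) → Finset (Fin m × Fin m) := fun ik =>
      (univ.filter fun b => (p ik.1).2 b ≠ (p ik.2).2 b).image fun b => ((p ik.2).1 b, b) with hsig
  -- first uses
  set NP : Finset (Fin (n + 1)) := univ.filter fun k => ∀ i, i < k → (p i).1 ≠ (p k).1 with hNP
  have hNPmem : ∀ k, k ∈ NP ↔ ∀ i, i < k → (p i).1 ≠ (p k).1 := by
    intro k
    rw [hNP, Finset.mem_filter]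
    exact ⟨fun h => h.2, fun h => ⟨mem_univ _, h⟩⟩
  -- (1) every position is a first use or the later endpoint of a step
  have h1 : ∀ k : Fin (n + 1), k ∈ NP ∨ ∃ i, (i, k) ∈ St := by
    intro k
    by_cases h : ∃ i, i < k ∧ (p i).1 = (p k).1
    · right
      obtain ⟨i₀, hi₀⟩ := h
      set S : Finset (Fin (n + 1)) := univ.filter fun i => i < k ∧ (p i).1 = (p k).1 with hS
      have hSmem : ∀ i, i ∈ S ↔ i < k ∧ (p i).1 = (p k).1 := by
        intro i
        rw [hS, Finset.mem_filter]
        exact ⟨fun h => h.2, fun h => ⟨mem_univ _, h⟩⟩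
      have hSne : S.Nonempty := ⟨i₀, (hSmem i₀).2 hi₀⟩
      obtain ⟨hlt, hperm⟩ := (hSmem _).1 (S.max'_mem hSne)
      refine ⟨S.max' hSne, (hStmem _).2 ⟨hlt, hperm, fun j hj hjk heq => ?_⟩⟩
      exact absurd (S.le_max' j ((hSmem j).2 ⟨hjk, heq⟩)) (not_le.mpr hj)
    · left
      push Not at h
      exact (hNPmem k).2 h
  -- (2) `n + 1 ≤ |NP| + |St|`
  have h2 : n + 1 ≤ NP.card + St.card := by
    have hsub : (univ : Finset (Fin (n + 1))) ⊆ NP ∪ St.image Prod.snd := by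
      intro k _
      rcases h1 k with h | ⟨i, hi⟩
      · exact Finset.mem_union_left _ h
      · exact Finset.mem_union_right _ (Finset.mem_image.mpr ⟨(i, k), hi, rfl⟩)
    calc n + 1 = (univ : Finset (Fin (n + 1))).card := by rw [Finset.card_univ, Fintype.card_fin]
      _ ≤ (NP ∪ St.image Prod.snd).card := Finset.card_le_card hsub
      _ ≤ NP.card + (St.image Prod.snd).card := Finset.card_union_le _ _
      _ ≤ NP.card + St.card := Nat.add_le_add_left Finset.card_image_le _
  -- (3) first uses are at most the distinct permutations
  have h3 : NP.card ≤ (univ.image fun k => (p k).1).card := by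
    refine Finset.card_le_card_of_injOn (fun k => (p k).1)
      (fun k _ => Finset.mem_image.mpr ⟨k, mem_univ _, rfl⟩) ?_
    intro k hk k' hk' hkk'
    by_contra hne
    rcases lt_or_gt_of_ne hne with h | h
    · exact (hNPmem k').1 hk' k h hkk'
    · exact (hNPmem k).1 hk k' h (Eq.symm hkk')
  -- (4) charge `R + 1` units per step: `R + 1 − r` to the signature and `r` to the change mass
  have h4 : (R + 1) * St.card ≤
      ∑ ik ∈ St, (R + 1 - (sig ik).card) + ∑ ik ∈ St, (univ.filter fun b => (p ik.1).2 b ≠ (p ik.2).2 b).card := by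
    have e1 : (R + 1) * St.card = ∑ _ik ∈ St, (R + 1) := by rw [Finset.sum_const, smul_eq_mul, mul_comm]
    rw [e1, ← Finset.sum_add_distrib]
    refine Finset.sum_le_sum fun ik _ => ?_
    have : (sig ik).card ≤ (univ.filter fun b => (p ik.1).2 b ≠ (p ik.2).2 b).card := Finset.card_image_le
    omega
  -- (5) the signature charge, fibrewise
  have h5 : ∑ ik ∈ St, (R + 1 - (sig ik).card) ≤ (K - 1) * ∑ s ∈ St.image sig, (R + 1 - s.card) := by
    rw [← Finset.sum_fiberwise_of_maps_to' (s := St) (t := St.image sig) (g := sig)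
      (fun ik hik => Finset.mem_image_of_mem sig hik) (fun s => R + 1 - s.card), Finset.mul_sum]
    refine Finset.sum_le_sum fun s _ => ?_
    rw [Finset.sum_const, smul_eq_mul]
    exact Nat.mul_le_mul_right _ (card_sigFibre_le d v ε θ p hθ hdom halt s)
  -- (6) the change mass
  have h6 := sum_card_chg_le d v ε θ p hθ hdom St (fun ik hik => (hStmem ik).1 hik)
  calc (R + 1) * (n + 1) ≤ (R + 1) * NP.card + (R + 1) * St.card := by
        rw [← Nat.mul_add]; exact Nat.mul_le_mul_left _ h2
    _ ≤ (R + 1) * (univ.image fun k => (p k).1).card +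
        ((K - 1) * ∑ s ∈ St.image sig, (R + 1 - s.card) +
          (K - 1) * ((univ.image fun k => (p k).1).card * m)) :=
        Nat.add_le_add (Nat.mul_le_mul_left _ h3) (h4.trans (Nat.add_le_add h5 h6))
    _ = _ := by rw [Nat.mul_add]


/-- **PARTIAL PERMUTATION COUNT.**  The changed cell-sets of size `r` occurring at the steps of the chain number at most
`N_r = C(m,r)·m!/(m−r)!` (`= C(m,r)²·r!`, the number of `r`-cell partial permutation matrices): such a cell-set is the graph of the
step's permutation over its `r` switched columns, hence determined by (column set, row labels in column order).
[folklore count; this cell] -/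
theorem card_sig_filter_le (r : ℕ) :
    ((((univ.filter fun ik : Fin (n + 1) × Fin (n + 1) =>
          ik.1 < ik.2 ∧ (p ik.1).1 = (p ik.2).1 ∧ ∀ j, ik.1 < j → j < ik.2 → (p j).1 ≠ (p ik.2).1).image
        fun ik => (univ.filter fun b => (p ik.1).2 b ≠ (p ik.2).2 b).image fun b => ((p ik.2).1 b, b)).filter
      fun s => s.card = r).card) ≤ m.choose r * m.descFactorial r := by
  classical
  -- parametrise `r`-cell partial permutation matrices by (column set, injective row labelling in column order)
  set T : Finset (Finset (Fin m) × (Fin r ↪ Fin m)) := (univ : Finset (Fin m)).powersetCard r ×ˢ univ with hT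
  have hTcard : T.card = m.choose r * m.descFactorial r := by
    rw [hT, Finset.card_product, Finset.card_powersetCard, Finset.card_univ, Finset.card_univ, Fintype.card_fin,
      Fintype.card_embedding_eq, Fintype.card_fin, Fintype.card_fin]
  set ψ : Finset (Fin m) × (Fin r ↪ Fin m) → Finset (Fin m × Fin m) := fun Ce =>
      if h : Ce.1.card = r then univ.image fun i : Fin r => (Ce.2 i, Ce.1.orderEmbOfFin h i) else ∅ with hψ
  rw [← hTcard]
  refine le_trans (Finset.card_le_card ?_) (Finset.card_image_le (f := ψ))
  intro s hs
  obtain ⟨hs, hsr⟩ := Finset.mem_filter.mp hs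
  obtain ⟨ik, -, rfl⟩ := Finset.mem_image.mp hs
  set C := univ.filter fun b => (p ik.1).2 b ≠ (p ik.2).2 b with hC
  have hinj : Function.Injective fun b : Fin m => ((p ik.2).1 b, b) := fun b b' h => (Prod.mk.inj h).2
  have hCr : C.card = r := by rw [← hsr, Finset.card_image_of_injective _ hinj]
  refine Finset.mem_image.mpr ⟨(C, (C.orderEmbOfFin hCr).toEmbedding.trans (Equiv.toEmbedding (p ik.2).1)), ?_, ?_⟩
  · rw [hT, Finset.mem_product]
    exact ⟨Finset.mem_powersetCard.mpr ⟨Finset.subset_univ _, hCr⟩, mem_univ _⟩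
  · have e1 : ψ (C, (C.orderEmbOfFin hCr).toEmbedding.trans (Equiv.toEmbedding (p ik.2).1)) =
        univ.image fun i : Fin r =>
          (((C.orderEmbOfFin hCr).toEmbedding.trans (Equiv.toEmbedding (p ik.2).1)) i, C.orderEmbOfFin hCr i) := by
      rw [hψ]
      exact dif_pos hCr
    have e2 : (fun i : Fin r =>
        (((C.orderEmbOfFin hCr).toEmbedding.trans (Equiv.toEmbedding (p ik.2).1)) i, C.orderEmbOfFin hCr i)) =
        (fun b : Fin m => ((p ik.2).1 b, b)) ∘ (C.orderEmbOfFin hCr) := by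
      funext i
      rfl
    rw [e1, e2, ← Finset.image_image, Finset.image_orderEmbOfFin_univ]


/-- Grouping the signature charge by size: `Σ_{s ∈ Sig} (R+1−|s|) ≤ Σ_{r=1}^{R} (R+1−r)·N_r` with `N_r = C(m,r)·m!/(m−r)!`. -/
theorem sum_sig_le (hθ : StrictMono θ) (hdom : ∀ k, IsDominant d v ε (θ k) (p k))
    (halt : ∀ k : Fin n, termSign ε (p k.castSucc) * termSign ε (p k.succ) < 0) (R : ℕ) :
    (∑ s ∈ ((univ.filter fun ik : Fin (n + 1) × Fin (n + 1) =>
          ik.1 < ik.2 ∧ (p ik.1).1 = (p ik.2).1 ∧ ∀ j, ik.1 < j → j < ik.2 → (p j).1 ≠ (p ik.2).1).image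
        fun ik => (univ.filter fun b => (p ik.1).2 b ≠ (p ik.2).2 b).image fun b => ((p ik.2).1 b, b)),
          (R + 1 - s.card)) ≤ ∑ r ∈ Icc 1 R, (R + 1 - r) * (m.choose r * m.descFactorial r) := by
  classical
  set Sig := ((univ.filter fun ik : Fin (n + 1) × Fin (n + 1) =>
          ik.1 < ik.2 ∧ (p ik.1).1 = (p ik.2).1 ∧ ∀ j, ik.1 < j → j < ik.2 → (p j).1 ≠ (p ik.2).1).image
        fun ik => (univ.filter fun b => (p ik.1).2 b ≠ (p ik.2).2 b).image fun b => ((p ik.2).1 b, b)) with hSig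
  have hpos : ∀ s ∈ Sig, 0 < s.card := fun s hs => card_sig_pos d v ε θ p hθ hdom halt hs
  have hmaps : ∀ s ∈ Sig.filter (fun s => s.card ≤ R), s.card ∈ Icc 1 R := by
    intro s hs
    obtain ⟨hs1, hs2⟩ := Finset.mem_filter.mp hs
    exact Finset.mem_Icc.mpr ⟨hpos s hs1, hs2⟩
  calc ∑ s ∈ Sig, (R + 1 - s.card) = ∑ s ∈ Sig.filter (fun s => s.card ≤ R), (R + 1 - s.card) := by
        rw [Finset.sum_filter]
        refine Finset.sum_congr rfl fun s _ => ?_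
        split_ifs with h
        · rfl
        · omega
    _ = ∑ r ∈ Icc 1 R, ∑ s ∈ (Sig.filter (fun s => s.card ≤ R)).filter (fun s => s.card = r), (R + 1 - r) :=
        (Finset.sum_fiberwise_of_maps_to' hmaps _).symm
    _ ≤ ∑ r ∈ Icc 1 R, (R + 1 - r) * (m.choose r * m.descFactorial r) := by
        refine Finset.sum_le_sum fun r _ => ?_
        rw [Finset.sum_const, smul_eq_mul, mul_comm]
        refine Nat.mul_le_mul_left _ (le_trans (Finset.card_le_card ?_) (card_sig_filter_le p r))
        exact Finset.filter_subset_filter _ (Finset.filter_subset _ _)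

/-- **CHANGED-SET LAW for every `R`, permutation-count form.**  A sign-alternating dominant chain of `n + 1` terms using the set
`Π` of permutations satisfies, for every `R`,
`(R+1)(n+1) ≤ (R+1)·|Π| + (K−1)·(Σ_{r=1}^{R} (R+1−r)·N_r + m·|Π|)`, `N_r = C(m,r)·m!/(m−r)!`.
`R = 0`: the thin law `n + 1 ≤ (1 + m(K−1))|Π|` (p419330); `R = 1`: the half-thin law (p476649). [this cell, val-sym-trop-p4 g5] -/
theorem succ_mul_succ_le_changedSet (hθ : StrictMono θ) (hdom : ∀ k, IsDominant d v ε (θ k) (p k))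
    (halt : ∀ k : Fin n, termSign ε (p k.castSucc) * termSign ε (p k.succ) < 0) (R : ℕ) :
    (R + 1) * (n + 1) ≤ (R + 1) * (univ.image fun k => (p k).1).card + (K - 1) *
      ((∑ r ∈ Icc 1 R, (R + 1 - r) * (m.choose r * m.descFactorial r)) + (univ.image fun k => (p k).1).card * m) :=
  (succ_mul_succ_le_sig d v ε θ p hθ hdom halt R).trans
    (Nat.add_le_add_left (Nat.mul_le_mul_left _ (Nat.add_le_add_right (sum_sig_le d v ε θ p hθ hdom halt R) _)) _)

end Chain

/-! ## 2. The census rows -/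

/-- **CHANGED-SET LAW, census form (every `R`).**  `T(m,K) ≤ ⌊((R+1)·m! + (K−1)·(Σ_{r=1}^{R}(R+1−r)·N_r + m!·m)) / (R+1)⌋ − 1`
with `N_r = C(m,r)·m!/(m−r)!`.  A super-fat-corner bound (`K ≫ m`), off the window of the crux. [this cell, val-sym-trop-p4 g5] -/
theorem tropRootLawAt_changedSet (m K R : ℕ) :
    TropRootLawAt m K (((R + 1) * m.factorial + (K - 1) *
      ((∑ r ∈ Icc 1 R, (R + 1 - r) * (m.choose r * m.descFactorial r)) + m.factorial * m)) / (R + 1) - 1) := by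
  intro d v ε n θ p _hε hθ hdom halt
  classical
  have h := succ_mul_succ_le_changedSet d v ε θ p hθ hdom halt R
  have hPi : (univ.image fun k => (p k).1).card ≤ m.factorial :=
    (Finset.card_le_univ _).trans (le_of_eq (by rw [Fintype.card_perm, Fintype.card_fin]))
  have h2 : (n + 1) * (R + 1) ≤ (R + 1) * m.factorial + (K - 1) *
      ((∑ r ∈ Icc 1 R, (R + 1 - r) * (m.choose r * m.descFactorial r)) + m.factorial * m) := by
    rw [mul_comm]
    refine h.trans (Nat.add_le_add (Nat.mul_le_mul_left _ hPi) (Nat.mul_le_mul_left _ ?_))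
    exact Nat.add_le_add_left (Nat.mul_le_mul_right _ hPi) _
  have h3 : n + 1 ≤ ((R + 1) * m.factorial + (K - 1) *
      ((∑ r ∈ Icc 1 R, (R + 1 - r) * (m.choose r * m.descFactorial r)) + m.factorial * m)) / (R + 1) :=
    (Nat.le_div_iff_mul_le (Nat.succ_pos R)).mpr h2
  omega

/-- **Row `m = 5`** (`R = 2`, `N_1 = 25`, `N_2 = 200`): `3(T(5,K)+1) ≤ 360 + 850(K−1)`, i.e. `T(5,K) ≤ 119 + ⌊850(K−1)/3⌋`
(`≈ 283.3` per class; half-thin p476649: `312.5`; thin: `600`).  The first size at which `R = 2` beats `R = 1`. -/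
theorem tropRootLawAt_five_changedSet (K : ℕ) : TropRootLawAt 5 K (119 + 850 * (K - 1) / 3) := by
  have h := tropRootLawAt_changedSet 5 K 2
  have hS : (∑ r ∈ Icc 1 2, (2 + 1 - r) * (Nat.choose 5 r * Nat.descFactorial 5 r)) = 250 := by decide
  have hf : Nat.factorial 5 = 120 := by decide
  rw [hS, hf] at h
  refine tropRootLawAt_mono (le_of_eq ?_) h
  omega

/-- **Row `m = 6`** (`R = 2`, `N_1 = 36`, `N_2 = 450`): `T(6,K) + 1 ≤ 720 + 1614(K−1)` (half-thin: `2178` per class; thin: `4320`). -/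
theorem tropRootLawAt_six_changedSet (K : ℕ) : TropRootLawAt 6 K (719 + 1614 * (K - 1)) := by
  have h := tropRootLawAt_changedSet 6 K 2
  have hS : (∑ r ∈ Icc 1 2, (2 + 1 - r) * (Nat.choose 6 r * Nat.descFactorial 6 r)) = 522 := by decide
  have hf : Nat.factorial 6 = 720 := by decide
  rw [hS, hf] at h
  refine tropRootLawAt_mono (le_of_eq ?_) h
  omega

/-- **Row `m = 7`** (`R = 3`, `N_1 = 49`, `N_2 = 882`, `N_3 = 7350`): `4(T(7,K)+1) ≤ 20160 + 44541(K−1)`, i.e.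
`T(7,K) ≤ 5039 + ⌊44541(K−1)/4⌋` (`≈ 11135` per class; half-thin: `17664.5`; thin: `35280`). -/
theorem tropRootLawAt_seven_changedSet (K : ℕ) : TropRootLawAt 7 K (5039 + 44541 * (K - 1) / 4) := by
  have h := tropRootLawAt_changedSet 7 K 3
  have hS : (∑ r ∈ Icc 1 3, (3 + 1 - r) * (Nat.choose 7 r * Nat.descFactorial 7 r)) = 9261 := by decide
  have hf : Nat.factorial 7 = 5040 := by decide
  rw [hS, hf] at h
  refine tropRootLawAt_mono (le_of_eq ?_) h
  omega

end RefreshExclusivity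

end Summit.ValiantsHypothesis.ValiantsHypothesis.Theorems.KPlusLogSqLaw
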